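import Summits.ABC.IUTFork.Repair.CandInternal10
import Summits.ABC.IUTFork.Repair.CandInternal13
import Summits.ABC.IUTFork.Cor312PilotKummerNaturalAct
import Summits.ABC.IUTFork.Repair.ScalarShellsThm311
import HarnessLib

/-!
# IUT REPAIR branch (rung LADDER-ABC:A2.RP), sub-cell B0 class (i) INTERNAL, file `CandInternal22` (abc-iut-rp-d1, gen 2): the d1 Λ-rows
# RP-I03a (`CandInternal1.H`), RP-I03b (`CandInternal1.Hins`), RP-I13 (`CandInternal10.H`), RP-I14 (`CandInternal13.H`) on the
# NON-(Ind)-TRIVIAL beds P♮ / P♮⁺ (abc-iut-w5-d230, abc-iut-rp-d2) and SCAL (abc-iut-w4-d098) — REPAIR-SPEC v0.4 §3 PROFILE v0.4 / RULINGS #11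

Proof-only record file (D-0012; 0 definitions, 0 `Prop` facts, standard axioms) of the abc-iut cell's IUT REPAIR branch (human ruling D-0077(2);
director-abc MINT 2026-08-26T05:11:35Z + ERRATUM 05:12:15Z; seat abc-iut-rp-d1, k = 22 ≡ 1 (mod 3)). TAKES NO SIDE on [IUTchIII] Cor. 3.12 or on
any author; candidates stay hypotheses; typed ≠ proved; instantiated ≠ endorsed. Every model datum is consumed BY NAME: P♮ = abc-iut-w5-d230's
NATURAL model (`NaturalWitness.natFull` / `natSetting` / `segRegion` / `qDatumNat := flipFamily · PsiNat`, `Cor312PilotKummerNaturalModel/…Witness`),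
P♮⁺ = abc-iut-rp-d2's honest-action variant (`NaturalActWitness.actFull` / `actSetting`, `Cor312PilotKummerNaturalAct`), SCAL = abc-iut-w4-d098's
scaling shells (`ScalarShellsThm311.sFull p`, "Ism" = all of `ℚˣ`; the (Ind2)-family `sFamDep (cQ p)` with `starAut_cQ_Psi : sFamDep cQ · Ψ = qDatum`).
The RULE served (REPAIR-SPEC v0.4 §3, PROFILE v0.4): «every candidate whose H mentions ⟨Ind1∪Ind2⟩, a class Λ, a transport … gets a T-b cell on P♮
and U (and SCAL when landed) BEFORE its word» — U is `Repair.CandInternal19` (p431321); this file is P♮ / P♮⁺ / SCAL.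

## WHAT THE BEDS DECIDE (kernel, this file; «RF1» = the inline link transport `∃ Φ₀ ∈ Λ, ∃ m₀, qK = Φ₀ · frobΨ_n m₀` of `CandInternal1`)
At the countermodel of record CM the two conjuncts of the class-(i) level-C supplier `H ∧ RF1` never hold together and the binder `Λ` decides
which fails (`CandInternal1`, `CandInternal10.not_linkTransport_at_pinned_of_H`, `CandInternal13.not_radial_and_coric_at_pinned`). On the
non-(Ind)-trivial beds this EXCLUSIVITY DISAPPEARS exactly where ⟨Ind2⟩ contains a family carrying the Θ-pilot's Kummer datum onto the q-pilot's:
* **P♮ (§1)**: for the transporting family `Λ = {flipFamily}` ⊆ ⟨Ind2⟩ (and for print's `Λ = ⟨Ind2⟩`): RP-I03a `H` HOLDS, RP-I13 HOLDS, RF1 HOLDS,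
  RP-I03b `Hins` FAILS (`flipFamily · {onePt} ≠ {onePt}`), and `Hins ∧ RF1` is FALSE for EVERY `Λ` (it says `qK = Ψ`, the identified datum).
  With P♮'s own facts (typed Thm 3.11, BridgeHyps, `|log(q)| > 0`, three pins, S, all four levels, STRICT Statement, ¬IdentifiedReading) this is
  the **T-c upgrade SAT0 ↦ SAT♮ for RP-I03a and RP-I13** (`satNatural_RP_I03a_I13`), while RP-I03b is capped at SAT0 BY THEOREM on this bed
  (`not_Hins_and_linkTransport_nat`).
* **P♮⁺ (§2, honest action)**: RP-I14's RADIAL reading HOLDS for every `Λ ∋ flipFamily` (`flipFamily` intertwines `onePt · x = x` into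
  `(−onePt) · x = −x`) and FAILS for `Λ = {1}`; so at P♮⁺ ONE family `{flipFamily}` is CORIC (RP-I13), TRANSPORTING (RF1) and RADIAL (RP-I14) at
  once (`coric_transport_radial_at_natAct`) — the CM exclusivity is a property of the honest `j²`-data over sign indeterminacies, not of the
  typed interface. (At P♮ itself the action field is `0`, so RP-I14 holds there degenerately for every nonempty `Λ` — cause named, as in
  `Repair.CandInternal2Nat`.)
* **SCAL (§3)**: for EVERY Cor. 3.12 setting over `sFull p` and abc-iut-w4-d101's q-datum `qDatum p`: `Hins ⟨Ind2⟩` FAILS (contrast CM: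
  `CandInternal1.Hins_at_pinned_closure_Ind2` HOLDS), `H`, RP-I13 and RF1 HOLD for the transporting (Ind2)-family `{sFamDep (cQ p)}`, hence
  `PilotKummerCompat` (abc-iut-rp-m1 `CandMochizuki1.pilotKummerCompat_at_scal`, same witness) and S = `PilotKummerIndRelated` for EVERY region
  operator `ρ` — on the bed where Step (x) log-volume invariance fails (`ScalarShellsThm311.logvol_not_invariant`: door (b), grade SAT⊖).
READING (neutral, class (i)): the [EtTh]-backed half of the d1 supplier («the link acts on the Θ Kummer data as an ⟨Ind2⟩-indeterminacy») and
its repair-fact half («… and transports them onto qK») are JOINTLY satisfiable with S exactly on beds whose (Ind2) moves the Θ datum onto the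
q datum — isometrically at P♮ (sign on a sign-asymmetric region; SAT♮, Statement strict) or non-isometrically at SCAL (door (b)) — and on no
bed where (Ind2) fixes the Θ datum's valuations (CM: signs; U: units, `CandInternal19`). No side taken; T-d by the referee lanes.
-/

noncomputable section

open Set

namespace Summit.ABC.IUTFork.Repair

open Thm311 Cor312 Cor312Vol Literature.IUT.LogThetaLattice

namespace CandInternal22

/-! ## 1. P♮ (abc-iut-w5-d230): the transporting family is an (Ind2)-isometry moving the Θ datum -/

section Natural

open Cor312.Checks Cor312.IdentifiedNonVacuity NaiveWitness PinnedWitness NaturalWitness NaturalActWitness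

/-- In P♮ and in P♮⁺ every column Kummer image of the Θ-pilot splitting monoid is the one-point datum `PsiNat = {onePt}` (identity Kummer
transport, same column on every line). [folklore] -/
theorem nat_frobΨ (n m : ℤ) (v : toyIndex.V) (hv : v ∈ toyIndex.Vbad) :
    (natFull.toLatticeSituation.col n).frobΨ m v hv = PsiNat v ∧ (actFull.toLatticeSituation.col n).frobΨ m v hv = PsiNat v :=
  ⟨rfl, rfl⟩

/-- **`flipFamily` MOVES the Θ datum**: `flipFamily · {onePt} ≠ {onePt}` (the label-1 coordinate of `onePt` is `1`, of its flip `−1`). [folklore] -/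
theorem flip_PsiNat_ne (v : toyIndex.V) : signShells.starAut flipFamily v '' PsiNat v ≠ PsiNat v := by
  intro h
  have hmem : signShells.starAut flipFamily v (onePt v) ∈ PsiNat v := by
    rw [← h]; exact ⟨onePt v, rfl, rfl⟩
  have h1 : signShells.starAut flipFamily v (onePt v) = onePt v := Set.mem_singleton_iff.1 hmem
  have hl : line 1 (toyIndex.over v) (onePt v ⟨1, by decide⟩) = 1 := by
    rw [show onePt v ⟨1, by decide⟩ = lpt 1 (toyIndex.over v) 1 from rfl, line_lpt]
  have h2 : line 1 (toyIndex.over v) (signShells.starAut flipFamily v (onePt v) ⟨1, by decide⟩) =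
      line 1 (toyIndex.over v) (onePt v ⟨1, by decide⟩) := by rw [h1]
  have hfl : line 1 (toyIndex.over v) (signShells.starAut flipFamily v (onePt v) ⟨1, by decide⟩) = -1 := by
    show line 1 (toyIndex.over v) (flipFamily 1 (toyIndex.over v) (onePt v ⟨1, by decide⟩)) = -1
    rw [flipFamily_apply, map_neg, hl]
  rw [hfl, hl] at h2
  norm_num at h2

/-- **RP-I03b at P♮: `Hins` FAILS for every `Λ ∋ flipFamily`** (any setting over `natFull`; the column does not depend on `n`). [folklore] -/
theorem not_Hins_nat_of_mem (P : Cor312.Setting natFull.toLatticeSituation.toSituation) {Λ : Set signShells.PacketAut}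
    (hΛ : flipFamily ∈ Λ) : ¬ CandInternal1.Hins natFull.toLatticeSituation P Λ := fun h => by
  obtain ⟨v, hv⟩ := toyIndex.Vbad_nonempty
  exact flip_PsiNat_ne v (h flipFamily hΛ 0 v hv)

/-- … in particular for print's instantiation `Λ = ⟨Ind2⟩` (Step (x) p.180 l.53–57) — CONTRAST: at CM `Hins ⟨Ind2⟩` HOLDS
(`CandInternal1.Hins_at_pinned_closure_Ind2`), at U it FAILS (`CandInternal19.not_Hins_unit_closure_Ind2`). [folklore] -/
theorem not_Hins_nat_closure_Ind2 (P : Cor312.Setting natFull.toLatticeSituation.toSituation) :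
    ¬ CandInternal1.Hins natFull.toLatticeSituation P (Subgroup.closure signShells.Ind2Family : Set signShells.PacketAut) :=
  not_Hins_nat_of_mem P (Subgroup.subset_closure flipFamily_mem_Ind2Family)

/-- **RP-I03a at P♮: `H` HOLDS for the transporting family `{flipFamily}`** (an (Ind2)-family: `Φ' = Φ`). [folklore] -/
theorem H_nat_flip (P : Cor312.Setting natFull.toLatticeSituation.toSituation) :
    CandInternal1.H natFull.toLatticeSituation P {flipFamily} :=
  CandInternal1.H_of_subset_closure_Ind2 _ _ _ (by
    rintro _ rfl; exact Subgroup.subset_closure flipFamily_mem_Ind2Family)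

/-- **RP-I13 at P♮: the decoupling reading HOLDS for the transporting family** (`{flipFamily} ⊆ ⟨Ind2⟩`) — CONTRAST: at CM the transporting
family is NOT coric (`CandInternal10.not_H_linkFamily`). [folklore] -/
theorem candInternal10H_flip : CandInternal10.H natFull.toLatticeSituation {flipFamily} := by
  rintro _ rfl; exact Subgroup.subset_closure flipFamily_mem_Ind2Family

/-- **RF1 HOLDS at P♮ for `Λ = {flipFamily}`**: the q-pilot's Kummer datum IS the flip-transport of the column Kummer image (abc-iut-w5-d230's
definition `qDatumNat := flipFamily · PsiNat`). [folklore] -/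
theorem linkTransport_nat_flip (P : Cor312.Setting natFull.toLatticeSituation.toSituation) :
    ∃ Φ₀ ∈ ({flipFamily} : Set signShells.PacketAut), ∃ m₀ : ℤ, ∀ (v : toyIndex.V) (hv : v ∈ toyIndex.Vbad),
      qDatumNat v hv = signShells.starAut Φ₀ v '' (natFull.toLatticeSituation.col P.n).frobΨ m₀ v hv :=
  ⟨flipFamily, rfl, 0, fun _ _ => rfl⟩

/-- … and for print's `Λ = ⟨Ind2⟩`. [folklore] -/
theorem linkTransport_nat_closure_Ind2 (P : Cor312.Setting natFull.toLatticeSituation.toSituation) :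
    ∃ Φ₀ ∈ (Subgroup.closure signShells.Ind2Family : Set signShells.PacketAut), ∃ m₀ : ℤ, ∀ (v : toyIndex.V) (hv : v ∈ toyIndex.Vbad),
      qDatumNat v hv = signShells.starAut Φ₀ v '' (natFull.toLatticeSituation.col P.n).frobΨ m₀ v hv :=
  ⟨flipFamily, Subgroup.subset_closure flipFamily_mem_Ind2Family, 0, fun _ _ => rfl⟩

/-- **`Hins ∧ RF1` is FALSE at P♮ for EVERY `Λ`**: together they say «`qK` IS a column Kummer image of the Θ-pilot splitting monoid»
(`CandInternal1.linkTransport_iff_eq_frobΨ_of_Hins`), i.e. `flipFamily · {onePt} = {onePt}`. So on this bed the insulated supplier RP-I03b ∧ RF1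
is capped at the identified grade BY THEOREM, while RP-I03a ∧ RF1 holds (next theorem). [folklore] -/
theorem not_Hins_and_linkTransport_nat (P : Cor312.Setting natFull.toLatticeSituation.toSituation) (Λ : Set signShells.PacketAut) :
    ¬ (CandInternal1.Hins natFull.toLatticeSituation P Λ ∧
        ∃ Φ₀ ∈ Λ, ∃ m₀ : ℤ, ∀ (v : toyIndex.V) (hv : v ∈ toyIndex.Vbad),
          qDatumNat v hv = signShells.starAut Φ₀ v '' (natFull.toLatticeSituation.col P.n).frobΨ m₀ v hv) := by
  rintro ⟨hins, Φ₀, hΦ₀, m₀, hq⟩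
  obtain ⟨v, hv⟩ := toyIndex.Vbad_nonempty
  have h1 := hq v hv
  rw [hins Φ₀ hΦ₀ m₀ v hv] at h1
  exact flip_PsiNat_ne v h1

/-- **T-c UPGRADE for RP-I03a / RP-I13: SAT♮** (REPAIR-SPEC v0.3 grades). At P♮, with print's instantiation `Λ = ⟨Ind2⟩`: typed Thm. 3.11,
BridgeHyps, `|log(q)| > 0`, the three pins, RP-I03a `H`, RP-I13, RF1, NOT RP-I03b, the datum clause `PilotKummerCompat`, S = `PilotKummerIndRelated`,
the hull clause, the Statement with STRICT inequality, and ¬IdentifiedReading ALL hold — the class-(i) exact-transport supplier is consistent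
with a contentful, non-collapsing Cor. 3.12 (previous grade SAT0 at P♭, `CandInternal1.H_linkTransport_satisfiable`). By abc-iut-w5-d230's
`natural_honesty_vector` the bed violates exactly the `j²`-scaling clause. [claim: Mochizuki2012, status: disputed] -/
theorem satNatural_RP_I03a_I13 :
    natFull.Statement ∧ BridgeHyps natSetting ∧ natSetting.AbsLogQPos ∧
      PinnedRegions3 natFull.toLatticeSituation natSetting segRegion qDatumNat ∧
      CandInternal1.H natFull.toLatticeSituation natSetting (Subgroup.closure signShells.Ind2Family : Set signShells.PacketAut) ∧
      CandInternal10.H natFull.toLatticeSituation (Subgroup.closure signShells.Ind2Family : Set signShells.PacketAut) ∧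
      (∃ Φ₀ ∈ (Subgroup.closure signShells.Ind2Family : Set signShells.PacketAut), ∃ m₀ : ℤ,
        ∀ (v : toyIndex.V) (hv : v ∈ toyIndex.Vbad),
          qDatumNat v hv = signShells.starAut Φ₀ v '' (natFull.toLatticeSituation.col natSetting.n).frobΨ m₀ v hv) ∧
      ¬ CandInternal1.Hins natFull.toLatticeSituation natSetting (Subgroup.closure signShells.Ind2Family : Set signShells.PacketAut) ∧
      PilotKummerCompat natFull.toLatticeSituation natSetting qDatumNat ∧
      PilotKummerIndRelated natFull.toLatticeSituation natSetting segRegion qDatumNat ∧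
      PilotKummerCompatHull natFull.toLatticeSituation natSetting segRegion qDatumNat ∧
      natSetting.Statement ∧ ((natSetting.negLogQ : ℝ) : WithTop ℝ) < natSetting.negLogTheta ∧ ¬ natSetting.IdentifiedReading :=
  ⟨natFull_statement, natSetting_bridgeHyps, natSetting_absLogQPos, natSetting_pinnedRegions3,
    CandInternal1.H_of_subset_closure_Ind2 _ _ _ (fun _ h => h), fun _ h => h, linkTransport_nat_closure_Ind2 natSetting,
    not_Hins_nat_closure_Ind2 natSetting, natSetting_pilotKummerCompat, natSetting_pilotKummerIndRelated, natSetting_pilotKummerCompatHull,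
    natSetting_statement_strict.1, natSetting_statement_strict.2, natSetting_not_identifiedReading⟩

/-- The same witness in the protocol's existential shape (RP-I03a ∧ RF1 with `Λ = ⟨Ind2⟩` is SAT♮), through abc-iut-w5-d230's engine
`satNatural_of_holds_at_natSetting`. [claim: Mochizuki2012, status: disputed] -/
theorem satNatural_RP_I03a_exists :
    ∃ (T : ThetaIndex) (F : FullSituation T) (P : Cor312.Setting F.toLatticeSituation.toSituation)
      (ρ : (∀ v : T.V, v ∈ T.Vbad → Set (F.L.StarPacket v)) → ∀ (j : T.Label) (vQ : T.VQ), Set (F.L.Packet j vQ))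
      (qK : ∀ v : T.V, v ∈ T.Vbad → Set (F.L.StarPacket v)),
      F.Statement ∧ BridgeHyps P ∧ P.AbsLogQPos ∧ PinnedRegions3 F.toLatticeSituation P ρ qK ∧
        (CandInternal1.H F.toLatticeSituation P (Subgroup.closure F.L.Ind2Family : Set F.L.PacketAut) ∧
          (∃ Φ₀ ∈ (Subgroup.closure F.L.Ind2Family : Set F.L.PacketAut), ∃ m₀ : ℤ, ∀ (v : T.V) (hv : v ∈ T.Vbad),
            qK v hv = F.L.starAut Φ₀ v '' (F.toLatticeSituation.col P.n).frobΨ m₀ v hv) ∧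
          ¬ CandInternal1.Hins F.toLatticeSituation P (Subgroup.closure F.L.Ind2Family : Set F.L.PacketAut)) ∧
        PilotKummerCompat F.toLatticeSituation P qK ∧ PilotKummerCompatRegion F.toLatticeSituation P ρ qK ∧
        PilotKummerIndRelated F.toLatticeSituation P ρ qK ∧ PilotKummerCompatHull F.toLatticeSituation P ρ qK ∧
        P.Statement ∧ ((P.negLogQ : ℝ) : WithTop ℝ) < P.negLogTheta ∧ ¬ P.IdentifiedReading :=
  satNatural_of_holds_at_natSetting
    (fun S P _ qK => CandInternal1.H S P (Subgroup.closure S.L.Ind2Family : Set S.L.PacketAut) ∧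
      (∃ Φ₀ ∈ (Subgroup.closure S.L.Ind2Family : Set S.L.PacketAut), ∃ m₀ : ℤ, ∀ v hv,
        qK v hv = S.L.starAut Φ₀ v '' (S.col P.n).frobΨ m₀ v hv) ∧
      ¬ CandInternal1.Hins S P (Subgroup.closure S.L.Ind2Family : Set S.L.PacketAut))
    ⟨CandInternal1.H_of_subset_closure_Ind2 _ _ _ (fun _ h => h), linkTransport_nat_closure_Ind2 natSetting,
      not_Hins_nat_closure_Ind2 natSetting⟩

/-- **RP-I14 at P♮ (degenerate, cause named): the radial reading HOLDS for every nonempty `Λ`** because P♮'s action field (i)(b) is the ZERO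
map (`natData.act := 0`, abc-iut-rp-d2 `CandInternal2Nat.natData_act`) — both sides of the intertwining identity are `0`. Not an arithmetic
verdict; the honest-action cell is `candInternal13H_act_of_mem` below. [folklore] -/
theorem candInternal13H_nat_of_nonempty (P : Cor312.Setting natFull.toLatticeSituation.toSituation) {Λ : Set signShells.PacketAut}
    (hΛ : Λ.Nonempty) : CandInternal13.H natFull.toLatticeSituation P qDatumNat Λ := by
  intro v hv
  obtain ⟨Φ, hΦ⟩ := hΛ
  refine ⟨Φ, hΦ, 0, onePt v, rfl, signShells.starAut flipFamily v (onePt v), ⟨onePt v, rfl, rfl⟩, fun x => ?_⟩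
  have h0 : ∀ ψ ι : signShells.StarPacket v, (natFull.toLatticeSituation.D P.n).act v hv ψ ι = 0 := fun _ _ => rfl
  rw [h0, h0, map_zero]

end Natural

/-! ## 2. P♮⁺ (honest action, abc-iut-rp-d2): one family is coric, transporting AND radial -/

section NaturalAct

open Cor312.Checks Cor312.IdentifiedNonVacuity NaiveWitness PinnedWitness NaturalWitness NaturalActWitness

/-- **RP-I14 at P♮⁺: the radial reading HOLDS for every `Λ ∋ flipFamily`** — `flipFamily` intertwines the action of the Θ-generator `onePt`
(`onePt · x = x`, `act_onePt`) into that of the q-generator `flipFamily · onePt` (`(−onePt) · x = −x`). [folklore] -/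
theorem candInternal13H_act_of_mem (P : Cor312.Setting actFull.toLatticeSituation.toSituation) {Λ : Set signShells.PacketAut}
    (hΛ : flipFamily ∈ Λ) : CandInternal13.H actFull.toLatticeSituation P qDatumNat Λ := by
  intro v hv
  refine ⟨flipFamily, hΛ, 0, onePt v, rfl, signShells.starAut flipFamily v (onePt v), ⟨onePt v, rfl, rfl⟩, fun x => ?_⟩
  rw [act_onePt]
  funext j
  show flipFamily j.1 (toyIndex.over v) (x j) =
    (line j.1 (toyIndex.over v) (flipFamily j.1 (toyIndex.over v) (onePt v j))) • x j
  rw [flipFamily_apply, flipFamily_apply, map_neg, show onePt v j = lpt j.1 (toyIndex.over v) 1 from rfl, line_lpt, neg_one_smul]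

/-- **RP-I14 at P♮⁺ FAILS for the trivial action `Λ = {1}`**: the identity does not intertwine `x ↦ x` into `x ↦ −x` (label-1 coordinate of
`onePt`: `1 ≠ −1`). So on the honest-action bed the radial reading is contentful. [folklore] -/
theorem not_candInternal13H_act_one (P : Cor312.Setting actFull.toLatticeSituation.toSituation) :
    ¬ CandInternal13.H actFull.toLatticeSituation P qDatumNat {(1 : signShells.PacketAut)} := by
  intro h
  obtain ⟨v, hv⟩ := toyIndex.Vbad_nonempty
  obtain ⟨Φ, hΦ, m, θ, hθ, κ, hκ, hx⟩ := h v hv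
  have hΦ1 : Φ = 1 := Set.mem_singleton_iff.1 hΦ
  have hθ1 : θ = onePt v := Set.mem_singleton_iff.1 hθ
  obtain ⟨ψ, hψ, rfl⟩ := hκ
  have hψ1 : ψ = onePt v := Set.mem_singleton_iff.1 hψ
  subst hΦ1 hθ1 hψ1
  have hl : line 1 (toyIndex.over v) (onePt v ⟨1, by decide⟩) = 1 := by
    rw [show onePt v ⟨1, by decide⟩ = lpt 1 (toyIndex.over v) 1 from rfl, line_lpt]
  have hL : line 1 (toyIndex.over v)
      (signShells.starAut (1 : signShells.PacketAut) v ((actFull.toLatticeSituation.D P.n).act v hv (onePt v) (onePt v)) ⟨1, by decide⟩) =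
        1 := by
    rw [act_onePt, LogShells.starAut_one]
    exact hl
  have hR : line 1 (toyIndex.over v)
      ((actFull.toLatticeSituation.D P.n).act v hv (signShells.starAut flipFamily v (onePt v)) (onePt v) ⟨1, by decide⟩) = -1 := by
    show line 1 (toyIndex.over v)
      ((line 1 (toyIndex.over v) (signShells.starAut flipFamily v (onePt v) ⟨1, by decide⟩)) • onePt v ⟨1, by decide⟩) = -1
    rw [map_smul, hl, smul_eq_mul, mul_one]
    show line 1 (toyIndex.over v) (flipFamily 1 (toyIndex.over v) (onePt v ⟨1, by decide⟩)) = -1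
    rw [flipFamily_apply, map_neg, hl]
  have h1 : line 1 (toyIndex.over v)
      (signShells.starAut (1 : signShells.PacketAut) v ((actFull.toLatticeSituation.D P.n).act v hv (onePt v) (onePt v)) ⟨1, by decide⟩) =
      line 1 (toyIndex.over v)
        ((actFull.toLatticeSituation.D P.n).act v hv (signShells.starAut flipFamily v (onePt v)) (onePt v) ⟨1, by decide⟩) := by
    rw [hx (onePt v)]
  rw [hL, hR] at h1
  norm_num at h1

/-- **`coric_transport_radial_at_natAct` — at P♮⁺ the CM-exclusivity of the three readings of the link-action binder DISAPPEARS.** For the one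
family `Λ = {flipFamily}`: RP-I13 (coric: `Λ ⊆ ⟨Ind2⟩`), RP-I03a `H`, RF1 (transport `qK = flipFamily · frobΨ_n 0`), RP-I14 (radial) all HOLD and
RP-I03b `Hins` FAILS — together with typed Thm. 3.11, BridgeHyps, `|log(q)| > 0`, the three pins, S, the hull clause and the STRICT Statement of
P♮⁺. CONTRAST at CM: `CandInternal13.not_radial_and_coric_at_pinned`, `CandInternal10.not_linkTransport_at_pinned_of_H`. [claim: Mochizuki2012, status: disputed] -/
theorem coric_transport_radial_at_natAct :
    actFull.Statement ∧ BridgeHyps actSetting ∧ actSetting.AbsLogQPos ∧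
      PinnedRegions3 actFull.toLatticeSituation actSetting segRegion qDatumNat ∧
      CandInternal10.H actFull.toLatticeSituation {flipFamily} ∧
      CandInternal1.H actFull.toLatticeSituation actSetting {flipFamily} ∧
      (∃ Φ₀ ∈ ({flipFamily} : Set signShells.PacketAut), ∃ m₀ : ℤ, ∀ (v : toyIndex.V) (hv : v ∈ toyIndex.Vbad),
        qDatumNat v hv = signShells.starAut Φ₀ v '' (actFull.toLatticeSituation.col actSetting.n).frobΨ m₀ v hv) ∧
      CandInternal13.H actFull.toLatticeSituation actSetting qDatumNat {flipFamily} ∧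
      ¬ CandInternal1.Hins actFull.toLatticeSituation actSetting {flipFamily} ∧
      PilotKummerIndRelated actFull.toLatticeSituation actSetting segRegion qDatumNat ∧
      PilotKummerCompatHull actFull.toLatticeSituation actSetting segRegion qDatumNat ∧
      actSetting.Statement ∧ ((actSetting.negLogQ : ℝ) : WithTop ℝ) < actSetting.negLogTheta := by
  have hcoric : CandInternal10.H actFull.toLatticeSituation {flipFamily} := by
    rintro _ rfl; exact Subgroup.subset_closure flipFamily_mem_Ind2Family
  refine ⟨actFull_statement, act_bridgeHyps, act_absLogQPos, act_pinnedRegions3, hcoric,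
    CandInternal1.H_of_subset_closure_Ind2 _ _ _ hcoric, ⟨flipFamily, rfl, 0, fun _ _ => rfl⟩,
    candInternal13H_act_of_mem actSetting rfl, fun h => ?_, act_pilotKummerIndRelated, act_pilotKummerCompatHull,
    act_statement_strict.1, act_statement_strict.2⟩
  obtain ⟨v, hv⟩ := toyIndex.Vbad_nonempty
  exact flip_PsiNat_ne v (h flipFamily rfl 0 v hv)

end NaturalAct

/-! ## 3. SCAL (abc-iut-w4-d098): the transporting family is a NON-isometric (Ind2)-scaling -/

section Scal

open Cor312.Checks Cor312.IdentifiedNonVacuity NaiveWitness PinnedWitness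
  Summit.ABC.IUTFork.Repair.ScalarShells Summit.ABC.IUTFork.Repair.ScalarShellsThm311

variable (p : ℕ) [hp : Fact p.Prime]

/-- The theta-value tuple `(q^{j²})_j` does not lie in abc-iut-w4-d101's q-datum `{(±q)_j}` (label 2: `q⁴ ≠ ±q`). [folklore] -/
theorem thetaValues_notMem_qDatum (v : toyIndex.V) (hv : v ∈ toyIndex.Vbad) : thetaValues p v ∉ PinnedWitness.qDatum p v hv := by
  intro h
  rw [CandInternal1.mem_qDatum_iff] at h
  have h2 := h ⟨2, by decide⟩
  have hval : line (2 : toyIndex.Label) (toyIndex.over v) (thetaValues p v ⟨2, by decide⟩) = (p : ℚ) ^ (4 : ℕ) := by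
    show line (2 : toyIndex.Label) (toyIndex.over v) ((line (2 : toyIndex.Label) (toyIndex.over v)).symm _) = _
    rw [LinearEquiv.apply_symm_apply]; rfl
  rw [hval] at h2
  have hp1 : (1 : ℚ) < p := by exact_mod_cast hp.out.one_lt
  have hp4 : (p : ℚ) < (p : ℚ) ^ (4 : ℕ) := by
    calc (p : ℚ) = (p : ℚ) ^ 1 := (pow_one _).symm
      _ < (p : ℚ) ^ 4 := pow_lt_pow_right₀ hp1 (by norm_num)
  have hp0 : (0 : ℚ) < (p : ℚ) ^ (4 : ℕ) := by positivity
  rcases h2 with h | h <;> linarith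

/-- **The (Ind2)-family `sFamDep (cQ p)` MOVES the Θ datum** (it carries `Ψ_v` onto `qDatum`, abc-iut-w4-d098 `starAut_cQ_Psi`, and
`qDatum ≠ Ψ_v`). [folklore] -/
theorem cQ_Psi_ne (v : toyIndex.V) (hv : v ∈ toyIndex.Vbad) :
    (scalingShells p).starAut (sFamDep p (cQ p)) v '' Psi p v ≠ Psi p v := by
  rw [starAut_cQ_Psi p v hv]
  intro h
  exact thetaValues_notMem_qDatum p v hv (h ▸ thetaValues_mem_Psi p v)

/-- **RP-I03b at SCAL: `Hins` FAILS for every `Λ ∋ sFamDep (cQ p)`**, for every Cor. 3.12 setting over the scaling shells. [folklore] -/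
theorem not_Hins_scal_of_mem (P : Cor312.Setting (sFull p).toLatticeSituation.toSituation) {Λ : Set (scalingShells p).PacketAut}
    (hΛ : sFamDep p (cQ p) ∈ Λ) : ¬ CandInternal1.Hins (sFull p).toLatticeSituation P Λ := fun h => by
  obtain ⟨v, hv⟩ := toyIndex.Vbad_nonempty
  have h1 := h _ hΛ 0 v hv
  rw [sColumn_frobΨ] at h1
  exact cQ_Psi_ne p v hv h1

/-- … in particular **`Hins ⟨Ind2⟩` FAILS at SCAL** — CONTRAST: at CM it HOLDS (`CandInternal1.Hins_at_pinned_closure_Ind2`). The insulated form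
reads «(Ind2) consists of isometries fixing the Θ datum»; the scaling shells deny exactly that. [folklore] -/
theorem not_Hins_scal_closure_Ind2 (P : Cor312.Setting (sFull p).toLatticeSituation.toSituation) :
    ¬ CandInternal1.Hins (sFull p).toLatticeSituation P
        (Subgroup.closure (scalingShells p).Ind2Family : Set (scalingShells p).PacketAut) :=
  not_Hins_scal_of_mem p P (Subgroup.subset_closure (sFamDep_mem_Ind2Family p (cQ p)))

/-- **RF1 HOLDS at SCAL for the transporting (Ind2)-family** `Λ = {sFamDep (cQ p)}` and abc-iut-w4-d101's q-datum: `qDatum = sFamDep cQ · frobΨ_n 0`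
for every setting (same witness as abc-iut-rp-m1's `CandMochizuki1.pilotKummerCompat_at_scal`). [folklore] -/
theorem linkTransport_scal_cQ (P : Cor312.Setting (sFull p).toLatticeSituation.toSituation) :
    ∃ Φ₀ ∈ ({sFamDep p (cQ p)} : Set (scalingShells p).PacketAut), ∃ m₀ : ℤ, ∀ (v : toyIndex.V) (hv : v ∈ toyIndex.Vbad),
      PinnedWitness.qDatum p v hv = (scalingShells p).starAut Φ₀ v '' ((sFull p).toLatticeSituation.col P.n).frobΨ m₀ v hv :=
  ⟨sFamDep p (cQ p), rfl, 0, fun v hv => by rw [sColumn_frobΨ]; exact (starAut_cQ_Psi p v hv).symm⟩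

/-- **`scal_cells` — the d1 Λ-rows at SCAL, packaged**, for EVERY setting `P` over `sFull p` and EVERY region operator `ρ`, with the transporting
family `Λ = {sFamDep (cQ p)}`: typed Thm. 3.11 holds (`sFull_statement`); RP-I13 HOLDS (the family is an (Ind2)-family — CONTRAST CM
`CandInternal10.not_H_linkFamily`); RP-I03a `H` HOLDS; RF1 HOLDS; RP-I03b `Hins` FAILS; hence the datum clause `PilotKummerCompat` and — by
Thm. 3.11 (ii)(b) KummerB (`sColumn_kummerB`) — S = `PilotKummerIndRelated` HOLD for every `ρ`; and Step (x) log-volume invariance FAILS on this bed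
(`logvol_not_invariant`: door (b), grade SAT⊖ in REPAIR-SPEC's words). [claim: Mochizuki2012, status: disputed] -/
theorem scal_cells (P : Cor312.Setting (sFull p).toLatticeSituation.toSituation)
    (ρ : (∀ v : toyIndex.V, v ∈ toyIndex.Vbad → Set ((scalingShells p).StarPacket v)) →
      ∀ (j : toyIndex.Label) (vQ : toyIndex.VQ), Set ((scalingShells p).Packet j vQ)) :
    (sFull p).Statement ∧
      CandInternal10.H (sFull p).toLatticeSituation {sFamDep p (cQ p)} ∧
      CandInternal1.H (sFull p).toLatticeSituation P {sFamDep p (cQ p)} ∧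
      (∃ Φ₀ ∈ ({sFamDep p (cQ p)} : Set (scalingShells p).PacketAut), ∃ m₀ : ℤ, ∀ (v : toyIndex.V) (hv : v ∈ toyIndex.Vbad),
        PinnedWitness.qDatum p v hv = (scalingShells p).starAut Φ₀ v '' ((sFull p).toLatticeSituation.col P.n).frobΨ m₀ v hv) ∧
      ¬ CandInternal1.Hins (sFull p).toLatticeSituation P {sFamDep p (cQ p)} ∧
      PilotKummerCompat (sFull p).toLatticeSituation P (PinnedWitness.qDatum p) ∧
      PilotKummerIndRelated (sFull p).toLatticeSituation P ρ (PinnedWitness.qDatum p) ∧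
      (∀ (j : toyIndex.Label) (vQ : toyIndex.VQ) (k : ℤ),
        ∃ Φ ∈ Subgroup.closure ((scalingShells p).Ind1Family ∪ (scalingShells p).Ind2Family),
          (sData p).Adm j vQ (sBall p ⊤ j vQ k) ∧
            (sData p).logvol j vQ (Φ j vQ '' sBall p ⊤ j vQ k) ≠ (sData p).logvol j vQ (sBall p ⊤ j vQ k)) := by
  have hcoric : CandInternal10.H (sFull p).toLatticeSituation {sFamDep p (cQ p)} := by
    rintro _ rfl; exact Subgroup.subset_closure (sFamDep_mem_Ind2Family p (cQ p))
  have hH : CandInternal1.H (sFull p).toLatticeSituation P {sFamDep p (cQ p)} := CandInternal1.H_of_subset_closure_Ind2 _ _ _ hcoric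
  have hPKC : PilotKummerCompat (sFull p).toLatticeSituation P (PinnedWitness.qDatum p) :=
    CandInternal1.pilotKummerCompat_of_H_of_linkTransport _ _ _ _ hH (linkTransport_scal_cQ p P)
  exact ⟨sFull_statement p, hcoric, hH, linkTransport_scal_cQ p P, not_Hins_scal_of_mem p P rfl, hPKC,
    pilotKummerIndRelated_of_pilotKummerCompat _ P ρ _ (sColumn_kummerB p P.n) hPKC, logvol_not_invariant p⟩

end Scal

end CandInternal22

end Summit.ABC.IUTFork.Repair

end
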